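import Literature.AnabelianGeometry.AbsoluteAnabelian.ArchimedeanHolFieldFunctorGeometricPSLUniformisedBaseFree
import Literature.NumberTheory.Automorphic.ModularLambdaCovering
import Literature.NumberTheory.Automorphic.ModularLambdaGammaTwo
import Literature.NumberTheory.Automorphic.ModularLambdaQExpansion
import HarnessLib

/-!
# `ℍ/Γ̄(2) ≅ ℙ¹ ∖ {0, 1, ∞}`: the explicit cusped base `Γ̄(2)` uniformises the tripod (PROOF-ONLY)

abc-iut cell, LINEAGE ROW «J2i-GAMMA2-MODEL» (GO abc-iut-L4-lead m61/m63), seat abc-iut-L4-d1, parts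
1b + 3 of the row AND the identification its part 1a (`…PSLGammaTwo.lean`) still disclaimed.
S. Mochizuki, *Topics in Absolute Anabelian Geometry III*, Def. 4.1 (i) p. 101 (the objects of `EA`
are hyperbolic Riemann surfaces such as the tripod `ℙ¹ ∖ {0, 1, ∞}`), proof of Prop. 4.2 (i) p. 106
(«the full subcategory of `EA` consisting of objects that map to `X` may … be identified with the
category of finite étale R-localizations `Loc_R(X)`»).  The tree's geometric column
(abc-iut-L4-t14 `…GeometricPSL*`) is stated at uniformised bases `X₀ = ℍ/Γ̄`; abc-iut-w6-d031's
junction `HolRS.exists_pslQuotient_iso_of_cover_transport` turns ANY holomorphic covering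
`k : ℍ → X` into `pslQuotient Λ̄ ≅ X` for the Möbius deck group `Λ̄` of `k`, known only through its
membership criterion.  Here the covering is EXPLICIT — Legendre's modular function

  `λ = θ₂⁴/θ₃⁴ : ℍ → ℂ ∖ {0, 1}`  (tree: `Literature/NumberTheory/Automorphic/ModularLambda*.lean`,
  `ModularLambda.isCoveringMap_modularLambda`, `modularLambda_eq_modularLambda_iff`,
  `modularLambda_smul`; Calegari–Dimitrov–Tang 2025 §1 p. 3 «`Y(2) ≅ ℙ¹ ∖ {0, 1, ∞}`»; Ahlfors Ch. 7
  §3.4) —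

and its deck group is computed: it IS the explicit arithmetic group of part 1a,

  `Γ̄(2) := π(Γ(2)) = ((CongruenceSubgroup.Gamma 2).map (SL₂(ℤ) → SL₂(ℝ))).map π ≤ PSL₂(ℝ)`

(spelled out everywhere, no definition; byte-identical to `…PSLGammaTwo.lean` and to abc-iut-L4-t12's
`…PSLArithmeticHfin.lean`).  Consequences, all THEOREMS (no definition, no instance, no named fact):

* `eq_pslGamma_two_of_deck_modularLambda` — a subgroup of `PSL₂(ℝ)` acting freely on `ℍ` whose
  membership criterion is `λ(q • τ) = λ(τ)` EQUALS `Γ̄(2)` (`⊇`: `Γ(2)`-invariance of `λ`; `⊆`: a fibre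
  of `λ` is a `Γ(2)`-orbit, and a deck transformation with a fixed point is trivial);
* ★ `pslGamma_two_uniformisation` — `Γ̄(2)` acts properly discontinuously and freely on `ℍ`, `λ` is the
  quotient covering map `ℍ → ℍ/Γ̄(2) = ℂ ∖ {0, 1}`, `π₁(ℂ ∖ {0, 1}, x) ≃* Γ̄(2)`,
  ★ `Γ̄(2) ≃* FreeGroup (Fin 2)`, ★ an ISOMORPHISM `pslQuotient Γ̄(2) ≅ planeComplFinite {0, 1}` of
  `HolRS` (`[τ] ↦ λ τ`; abc-iut-L4-t12's object = the thrice-punctured sphere `ℙ¹ ∖ {0, 1, ∞}`), and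
  the two transport equalities «maps to `ℍ/Γ̄(2)`» = «maps to `ℂ ∖ {0, 1}`» in `HolRS` and in print's
  RC-category;
* unpacked corollaries in the binder shapes the consumers take: `properlyDiscontinuousSMul_pslGamma_two`,
  `isCancelSMul_pslGamma_two` (row part 1b), `exists_isFreeGroup_pslGamma_two` (`IsFreeGroup` with
  `Nat.card Generators = 2`, row part 3), `exists_mul_ne_mul_pslGamma_two` (non-abelian),
  `nonempty_pslGamma_two_mulEquiv_freeGroup`, `exists_pslQuotient_pslGamma_two_iso_planeComplFinite`.

So the GENUINE tripod sits at the base `X₀ = ℍ/Γ̄(2)` of the geometric column with an explicit,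
arithmetic, torsion-free uniformising group: hypothesis (P) is part 1a
(`exists_parabolic_mem_pslGamma_two`), `hfin` is abc-iut-L4-t12's `hfin_of_isArithmetic`, and (FC) /
`hN` follow in the sequel.  HONEST FRAMING: classical (uniformisation of `Y(2)` by `λ`); MODEL side
of [AbsTopIII] §4 — model ≠ reconstruction; nothing here bears on the disputed [IUTchIII] Cor. 3.12.

## References

* S. Mochizuki, *Topics in Absolute Anabelian Geometry III* (2015), Def. 4.1 (i) p. 101, proof of
  Prop. 4.2 (i) p. 106. [MochizukiAbsTopIII2015]
* F. Calegari, V. Dimitrov, Y. Tang, *The unbounded denominators conjecture*, JAMS 38 (2025), §1 p. 3,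
  §5.1. [CalegariDimitrovTang2025]
* H. M. Farkas, I. Kra, *Riemann Surfaces*, 2nd ed. (1992), IV.5.5–IV.5.6, IV.6. [FarkasKra1992]
-/

set_option autoImplicit false

noncomputable section

open scoped Manifold ContDiff Topology UpperHalfPlane MatrixGroups
open _root_.MulAction _root_.CategoryTheory _root_.TopologicalSpace

namespace Literature.AnabelianGeometry.AbsoluteAnabelian

namespace HolRS

open Literature.NumberTheory.Automorphic (modularLambda)
open Literature.NumberTheory.Automorphic.ModularLambda

/-! ### §0 Bookkeeping: `SL₂(ℤ)` inside `PSL₂(ℝ)` -/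

/-- `γ ∈ SL₂(ℤ)` acts on `ℍ` through its image in `SL(2, ℝ)` (Möbius action, `Aut ℍ = PSL(2, ℝ)`).
[cite: FarkasKra1992, IV.5.6] -/
theorem map_intCast_smul (γ : SL(2, ℤ)) (τ : ℍ) :
    (Matrix.SpecialLinearGroup.map (Int.castRingHom ℝ) γ : SL(2, ℝ)) • τ = γ • τ := by
  apply UpperHalfPlane.ext
  rw [UpperHalfPlane.coe_specialLinearGroup_apply, UpperHalfPlane.coe_specialLinearGroup_apply]
  simp

/-- … hence through its image `π(γ)` in `PSL₂(ℝ) = Aut ℍ`. [cite: FarkasKra1992, IV.5.6] -/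
theorem mk_map_intCast_smul (γ : SL(2, ℤ)) (τ : ℍ) :
    (QuotientGroup.mk (Matrix.SpecialLinearGroup.map (Int.castRingHom ℝ) γ) : PSL2R) • τ = γ • τ := by
  rw [psl_mk_smul, map_intCast_smul]

/-- Membership in `Γ̄(2) = π(Γ(2)) ≤ PSL₂(ℝ) = Aut ℍ`: the images of the elements of `Γ(2)`.
[cite: FarkasKra1992, IV.5.6] -/
theorem mem_pslGamma_two_iff {q : PSL2R} :
    q ∈ ((CongruenceSubgroup.Gamma 2).map (Matrix.SpecialLinearGroup.map (Int.castRingHom ℝ))).map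
        (QuotientGroup.mk' (Subgroup.center SL(2, ℝ))) ↔
      ∃ γ ∈ CongruenceSubgroup.Gamma 2,
        (QuotientGroup.mk (Matrix.SpecialLinearGroup.map (Int.castRingHom ℝ) γ) : PSL2R) = q := by
  simp only [Subgroup.mem_map, QuotientGroup.mk'_apply, exists_exists_and_eq_and]

/-! ### §1 `λ` as a holomorphic covering of the tripod object of `HolRS` -/

/-- `λ(τ) ∈ ℂ ∖ {0, 1}` for `τ ∈ ℍ` (tree: `modularLambda_ne_zero/one`).
[cite: CalegariDimitrovTang2025, §1 p. 3] -/
theorem modularLambda_mem_compl_pair (τ : ℍ) :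
    modularLambda (τ : ℂ) ∈ (⟨({0, 1} : Set ℂ)ᶜ, (Set.toFinite ({0, 1} : Set ℂ)).isClosed.isOpen_compl⟩ :
      Opens ℂ) :=
  fun h => h.elim (modularLambda_ne_zero τ.2) (modularLambda_ne_one τ.2)

/-- **`λ : ℍ → ℂ ∖ {0, 1}` is a covering map of the tripod object `planeComplFinite {0, 1}`** (the
tree's `ModularLambda.isCoveringMap_modularLambda`, read in `HolRS`).
[cite: CalegariDimitrovTang2025, §1 p. 3 and §5.1] -/
theorem isCoveringMap_modularLambda_planeComplFinite :
    IsCoveringMap (fun τ : ℍ => (⟨modularLambda (τ : ℂ), modularLambda_mem_compl_pair τ⟩ :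
      (planeComplFinite ({0, 1} : Set ℂ) (Set.toFinite _)).carrier)) :=
  isCoveringMap_modularLambda

/-- `λ : ℍ → ℂ ∖ {0, 1}` is holomorphic as a map of Riemann surfaces into the tripod object.
[cite: CalegariDimitrovTang2025, §1 p. 3] -/
theorem mdifferentiable_modularLambda_planeComplFinite :
    MDifferentiable 𝓘(ℂ, ℂ) 𝓘(ℂ, ℂ) (fun τ : ℍ => (⟨modularLambda (τ : ℂ),
      modularLambda_mem_compl_pair τ⟩ : (planeComplFinite ({0, 1} : Set ℂ) (Set.toFinite _)).carrier)) := by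
  set k : ℍ → (planeComplFinite ({0, 1} : Set ℂ) (Set.toFinite _)).carrier :=
    fun τ => ⟨modularLambda (τ : ℂ), modularLambda_mem_compl_pair τ⟩ with hk_def
  have dk0 : MDifferentiable 𝓘(ℂ, ℂ) 𝓘(ℂ, ℂ) (fun τ : ℍ => modularLambda (τ : ℂ)) :=
    mdifferentiable_of_differentiableAt (g := modularLambda) fun _ hz => differentiableAt_modularLambda hz
  intro x
  have h1 : MDifferentiableAt 𝓘(ℂ, ℂ) 𝓘(ℂ, ℂ) (Subtype.val ∘ k) x ↔
      MDifferentiableAt 𝓘(ℂ, ℂ) 𝓘(ℂ, ℂ) k x :=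
    ChartedSpace.liftPropWithinAt_subtypeVal_comp_iff ..
  exact h1.mp (dk0 x)

/-! ### §2 The Möbius deck group of `λ` is `Γ̄(2)` -/

/-- **The Möbius deck group of `λ` is `Γ̄(2)`.**  If `Λ̄ ≤ PSL₂(ℝ)` acts freely on `ℍ` and
`q ∈ Λ̄ ↔ λ(q • τ) = λ(τ) ∀ τ`, then `Λ̄ = Γ̄(2) = π(Γ(2))`: `⊇` by the `Γ(2)`-invariance of `λ`
(`modularLambda_smul`); `⊆` because `λ(q • i) = λ(i)` puts `q • i` in the `Γ(2)`-orbit of `i`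
(`modularLambda_eq_modularLambda_iff`), so some `p ∈ Γ̄(2) ⊆ Λ̄` has `(p q) • i = i`, and a freely acting
`p q ∈ Λ̄` with a fixed point is `1`. [cite: CalegariDimitrovTang2025, §1 p. 3 and §5.1]
[cite: FarkasKra1992, IV.5.5–IV.5.6] -/
theorem eq_pslGamma_two_of_deck_modularLambda (Λ : Subgroup PSL2R) [IsCancelSMul Λ ℍ]
    (hΛ : ∀ q : PSL2R, q ∈ Λ ↔ ∀ τ : ℍ, modularLambda ((q • τ : ℍ) : ℂ) = modularLambda (τ : ℂ)) :
    Λ = ((CongruenceSubgroup.Gamma 2).map (Matrix.SpecialLinearGroup.map (Int.castRingHom ℝ))).map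
        (QuotientGroup.mk' (Subgroup.center SL(2, ℝ))) := by
  -- `Γ̄(2) ⊆ Λ̄`
  have hsub : ∀ γ ∈ CongruenceSubgroup.Gamma 2,
      (QuotientGroup.mk (Matrix.SpecialLinearGroup.map (Int.castRingHom ℝ) γ) : PSL2R) ∈ Λ :=
    fun γ hγ => (hΛ _).mpr fun τ => by rw [mk_map_intCast_smul]; exact modularLambda_smul hγ τ
  ext q
  refine ⟨fun hq => ?_, fun hq => ?_⟩
  · obtain ⟨γ, hγ, hγI⟩ :=
      modularLambda_eq_modularLambda_iff.mp ((hΛ q).mp hq UpperHalfPlane.I)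
    set p : PSL2R := QuotientGroup.mk (Matrix.SpecialLinearGroup.map (Int.castRingHom ℝ) γ) with hp
    have hpΛ : p ∈ Λ := hsub γ hγ
    have hfix : (⟨p * q, Λ.mul_mem hpΛ hq⟩ : Λ) • UpperHalfPlane.I = UpperHalfPlane.I := by
      change (p * q) • UpperHalfPlane.I = UpperHalfPlane.I
      rw [mul_smul, hp, mk_map_intCast_smul]
      exact hγI
    have h1 : (⟨p * q, Λ.mul_mem hpΛ hq⟩ : Λ) = 1 := IsCancelSMul.eq_one_of_smul hfix
    have hpq : p * q = 1 := congrArg Subtype.val h1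
    rw [eq_inv_of_mul_eq_one_right hpq]
    exact Subgroup.inv_mem _ (mem_pslGamma_two_iff.mpr ⟨γ, hγ, rfl⟩)
  · obtain ⟨γ, hγ, rfl⟩ := mem_pslGamma_two_iff.mp hq
    exact hsub γ hγ

/-! ### §3 `Γ̄(2)` uniformises the tripod -/

/-- ★ **`ℍ/Γ̄(2) ≅ ℙ¹ ∖ {0, 1, ∞}` by `λ`, with everything the geometric column consumes.**  `Γ̄(2)`
acts properly discontinuously and freely on `ℍ`; `λ : ℍ → ℂ ∖ {0, 1}` is the quotient covering map for
this action; `π₁(ℂ ∖ {0, 1}, x) ≃* Γ̄(2)` for every base point; `Γ̄(2) ≃* F₂`; `λ` descends to an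
ISOMORPHISM `pslQuotient Γ̄(2) ≅ planeComplFinite {0, 1}` of `HolRS`, `[τ] ↦ λ τ`; and the object
properties «maps to `ℍ/Γ̄(2)`» and «maps to `ℂ ∖ {0, 1}`» coincide, in `HolRS` and in the RC-category
(abc-iut-w6-d031's junction at the explicit covering `λ`, plus `eq_pslGamma_two_of_deck_modularLambda`
and the tree's `π₁(ℂ ∖ F) ≅ F_{|F|}`). [cite: MochizukiAbsTopIII2015, Proposition 4.2 (i) proof p.106]
[cite: CalegariDimitrovTang2025, §1 p. 3 and §5.1] [cite: FarkasKra1992, IV.5.5–IV.5.6] -/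
theorem pslGamma_two_uniformisation :
    ∃ (_ : ProperlyDiscontinuousSMul
        (((CongruenceSubgroup.Gamma 2).map (Matrix.SpecialLinearGroup.map (Int.castRingHom ℝ))).map
          (QuotientGroup.mk' (Subgroup.center SL(2, ℝ)))) ℍ)
      (_ : IsCancelSMul
        (((CongruenceSubgroup.Gamma 2).map (Matrix.SpecialLinearGroup.map (Int.castRingHom ℝ))).map
          (QuotientGroup.mk' (Subgroup.center SL(2, ℝ)))) ℍ),
      IsQuotientCoveringMap (fun τ : ℍ => (⟨modularLambda (τ : ℂ), modularLambda_mem_compl_pair τ⟩ :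
          (planeComplFinite ({0, 1} : Set ℂ) (Set.toFinite _)).carrier))
        (((CongruenceSubgroup.Gamma 2).map (Matrix.SpecialLinearGroup.map (Int.castRingHom ℝ))).map
          (QuotientGroup.mk' (Subgroup.center SL(2, ℝ)))) ∧
      (∀ x : (planeComplFinite ({0, 1} : Set ℂ) (Set.toFinite _)).carrier,
        Nonempty (FundamentalGroup (planeComplFinite ({0, 1} : Set ℂ) (Set.toFinite _)).carrier x ≃*
          (((CongruenceSubgroup.Gamma 2).map (Matrix.SpecialLinearGroup.map (Int.castRingHom ℝ))).map
            (QuotientGroup.mk' (Subgroup.center SL(2, ℝ)))))) ∧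
      Nonempty ((((CongruenceSubgroup.Gamma 2).map
          (Matrix.SpecialLinearGroup.map (Int.castRingHom ℝ))).map
            (QuotientGroup.mk' (Subgroup.center SL(2, ℝ)))) ≃* FreeGroup (Fin 2)) ∧
      (∃ e : pslQuotient (((CongruenceSubgroup.Gamma 2).map
            (Matrix.SpecialLinearGroup.map (Int.castRingHom ℝ))).map
              (QuotientGroup.mk' (Subgroup.center SL(2, ℝ)))) ≅
          planeComplFinite ({0, 1} : Set ℂ) (Set.toFinite _),
        ∀ τ : ℍ, e.hom.toFun (Quotient.mk _ τ) =
          (⟨modularLambda (τ : ℂ), modularLambda_mem_compl_pair τ⟩ :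
            (planeComplFinite ({0, 1} : Set ℂ) (Set.toFinite _)).carrier)) ∧
      ((fun Y : HolRS => Nonempty (Y ⟶ pslQuotient (((CongruenceSubgroup.Gamma 2).map
            (Matrix.SpecialLinearGroup.map (Int.castRingHom ℝ))).map
              (QuotientGroup.mk' (Subgroup.center SL(2, ℝ)))))) =
        fun Y : HolRS => Nonempty (Y ⟶ planeComplFinite ({0, 1} : Set ℂ) (Set.toFinite _))) ∧
      ((fun Y : RC => Nonempty (Y ⟶ toRC.obj (pslQuotient (((CongruenceSubgroup.Gamma 2).map
            (Matrix.SpecialLinearGroup.map (Int.castRingHom ℝ))).map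
              (QuotientGroup.mk' (Subgroup.center SL(2, ℝ))))))) =
        fun Y : RC => Nonempty (Y ⟶ toRC.obj (planeComplFinite ({0, 1} : Set ℂ) (Set.toFinite _)))) := by
  set X : HolRS := planeComplFinite ({0, 1} : Set ℂ) (Set.toFinite _) with hX
  set k : ℍ → X.carrier := fun τ => ⟨modularLambda (τ : ℂ), modularLambda_mem_compl_pair τ⟩ with hk_def
  have hk : IsCoveringMap k := isCoveringMap_modularLambda_planeComplFinite
  have dk : MDifferentiable 𝓘(ℂ, ℂ) 𝓘(ℂ, ℂ) k := mdifferentiable_modularLambda_planeComplFinite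
  -- the junction at the explicit covering `λ`, twice (covering clause / `π₁` + transport clauses)
  obtain ⟨Λ, hPD, hC, hΛ, -, hq, e, he⟩ := exists_pslQuotient_iso_of_cover X hk dk
  obtain ⟨Λ', hPD', hC', hΛ', hπ, -, hH, hR⟩ := exists_pslQuotient_iso_of_cover_transport X hk dk
  -- both deck groups are `Γ̄(2)`
  have hΛ1 : ∀ q : PSL2R, q ∈ Λ ↔ ∀ τ : ℍ, modularLambda ((q • τ : ℍ) : ℂ) = modularLambda (τ : ℂ) :=
    fun q => (hΛ q).trans (forall_congr' fun τ => Subtype.ext_iff)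
  have hΛ2 : ∀ q : PSL2R, q ∈ Λ' ↔ ∀ τ : ℍ, modularLambda ((q • τ : ℍ) : ℂ) = modularLambda (τ : ℂ) :=
    fun q => (hΛ' q).trans (forall_congr' fun τ => Subtype.ext_iff)
  have h1 := eq_pslGamma_two_of_deck_modularLambda Λ hΛ1
  have h2 := eq_pslGamma_two_of_deck_modularLambda Λ' hΛ2
  subst h1
  subst h2
  -- the free group of rank 2
  obtain ⟨x⟩ : Nonempty X.carrier := inferInstance
  obtain ⟨φ⟩ := hπ x
  obtain ⟨ψ⟩ :=
    Literature.AlgebraicTopology.FundamentalGroup.nonempty_mulEquiv_freeGroup_compl_finite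
      (Set.toFinite ({0, 1} : Set ℂ)) x
  have hcard : ({0, 1} : Set ℂ).ncard = 2 := Set.ncard_pair (zero_ne_one' ℂ)
  rw [hcard] at ψ
  exact ⟨hPD, hC, hq, hπ, ⟨φ.symm.trans ψ⟩, ⟨e, he⟩, hH, hR⟩

/-! ### §4 Unpacked corollaries in the consumers' binder shapes -/

/-- **`Γ̄(2)` acts properly discontinuously on `ℍ`** (row part 1b). [cite: FarkasKra1992, IV.5.5–IV.5.6] -/
theorem properlyDiscontinuousSMul_pslGamma_two :
    ProperlyDiscontinuousSMul
      (((CongruenceSubgroup.Gamma 2).map (Matrix.SpecialLinearGroup.map (Int.castRingHom ℝ))).map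
        (QuotientGroup.mk' (Subgroup.center SL(2, ℝ)))) ℍ := by
  obtain ⟨hPD, -, -⟩ := pslGamma_two_uniformisation
  exact hPD

/-- **`Γ̄(2)` acts freely on `ℍ`** (row part 1b; cf. the tree's `GammaTwoTorsionFree.smul_eq_self_iff`
for the `SL₂(ℤ)`-side statement). [cite: FarkasKra1992, IV.5.5–IV.5.6] -/
theorem isCancelSMul_pslGamma_two :
    IsCancelSMul
      (((CongruenceSubgroup.Gamma 2).map (Matrix.SpecialLinearGroup.map (Int.castRingHom ℝ))).map
        (QuotientGroup.mk' (Subgroup.center SL(2, ℝ)))) ℍ := by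
  obtain ⟨-, hC, -⟩ := pslGamma_two_uniformisation
  exact hC

/-- **`Γ̄(2) ≃* F₂`** (row part 3): `Γ̄(2) ≃* π₁(ℂ ∖ {0, 1}) ≃* FreeGroup (Fin 2)`.
[cite: FarkasKra1992, IV.5.5–IV.5.6] [cite: LyndonSchupp2001, Ch. I Prop. 2.7] -/
theorem nonempty_pslGamma_two_mulEquiv_freeGroup :
    Nonempty ((((CongruenceSubgroup.Gamma 2).map
        (Matrix.SpecialLinearGroup.map (Int.castRingHom ℝ))).map
          (QuotientGroup.mk' (Subgroup.center SL(2, ℝ)))) ≃* FreeGroup (Fin 2)) := by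
  obtain ⟨-, -, -, -, h, -⟩ := pslGamma_two_uniformisation
  exact h

/-- **`Γ̄(2)` is free of rank 2** in Mathlib's `IsFreeGroup` currency with `Nat.card Generators = 2`
(the binders `[IsFreeGroup Γ̄] [Finite (IsFreeGroup.Generators Γ̄)] (h2 : 2 ≤ Nat.card …)` of
abc-iut-L4-t14's closers). [cite: LyndonSchupp2001, Ch. I Prop. 2.7] -/
theorem exists_isFreeGroup_pslGamma_two :
    ∃ (_ : IsFreeGroup (((CongruenceSubgroup.Gamma 2).map
        (Matrix.SpecialLinearGroup.map (Int.castRingHom ℝ))).map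
          (QuotientGroup.mk' (Subgroup.center SL(2, ℝ)))))
      (_ : Finite (IsFreeGroup.Generators (((CongruenceSubgroup.Gamma 2).map
        (Matrix.SpecialLinearGroup.map (Int.castRingHom ℝ))).map
          (QuotientGroup.mk' (Subgroup.center SL(2, ℝ)))))),
      Nat.card (IsFreeGroup.Generators (((CongruenceSubgroup.Gamma 2).map
        (Matrix.SpecialLinearGroup.map (Int.castRingHom ℝ))).map
          (QuotientGroup.mk' (Subgroup.center SL(2, ℝ))))) = 2 := by
  obtain ⟨e⟩ := nonempty_pslGamma_two_mulEquiv_freeGroup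
  exact exists_isFreeGroup_of_mulEquiv e

/-- **`Γ̄(2)` is non-abelian** (the `hΓ` binder of abc-iut-L4-d1's normaliser theorems).
[cite: LyndonSchupp2001, Ch. I Prop. 2.16] -/
theorem exists_mul_ne_mul_pslGamma_two :
    ∃ x y : (((CongruenceSubgroup.Gamma 2).map (Matrix.SpecialLinearGroup.map (Int.castRingHom ℝ))).map
        (QuotientGroup.mk' (Subgroup.center SL(2, ℝ)))), x * y ≠ y * x := by
  obtain ⟨e⟩ := nonempty_pslGamma_two_mulEquiv_freeGroup
  exact Literature.GroupTheory.exists_mul_ne_mul_of_mulEquiv e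
    (Literature.GroupTheory.FreeGroup.exists_mul_ne_mul_fin le_rfl)

/-- **`π₁(ℙ¹ ∖ {0, 1, ∞}, x) ≃* Γ̄(2)`** for every base point. [cite: FarkasKra1992, IV.5.5–IV.5.6]
[cite: HatcherAT2002, §1.3 Prop. 1.40] -/
theorem nonempty_fundamentalGroup_mulEquiv_pslGamma_two
    (x : (planeComplFinite ({0, 1} : Set ℂ) (Set.toFinite _)).carrier) :
    Nonempty (FundamentalGroup (planeComplFinite ({0, 1} : Set ℂ) (Set.toFinite _)).carrier x ≃*
      (((CongruenceSubgroup.Gamma 2).map (Matrix.SpecialLinearGroup.map (Int.castRingHom ℝ))).map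
        (QuotientGroup.mk' (Subgroup.center SL(2, ℝ))))) := by
  obtain ⟨-, -, -, hπ, -⟩ := pslGamma_two_uniformisation
  exact hπ x

/-- ★ **`pslQuotient Γ̄(2) ≅ planeComplFinite {0, 1}` — the tripod IS `ℍ/Γ̄(2)` in `HolRS`**, together
with the two transport equalities of object properties (so every statement of the geometric column
about «objects mapping to `ℍ/Γ̄(2)`» IS the statement about «objects mapping to `ℙ¹ ∖ {0, 1, ∞}`»).
[cite: MochizukiAbsTopIII2015, Proposition 4.2 (i) proof p.106] [cite: FarkasKra1992, IV.5.5–IV.5.6] -/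
theorem exists_pslQuotient_pslGamma_two_iso_planeComplFinite :
    ∃ (_ : ProperlyDiscontinuousSMul
        (((CongruenceSubgroup.Gamma 2).map (Matrix.SpecialLinearGroup.map (Int.castRingHom ℝ))).map
          (QuotientGroup.mk' (Subgroup.center SL(2, ℝ)))) ℍ)
      (_ : IsCancelSMul
        (((CongruenceSubgroup.Gamma 2).map (Matrix.SpecialLinearGroup.map (Int.castRingHom ℝ))).map
          (QuotientGroup.mk' (Subgroup.center SL(2, ℝ)))) ℍ),
      Nonempty (pslQuotient (((CongruenceSubgroup.Gamma 2).map
            (Matrix.SpecialLinearGroup.map (Int.castRingHom ℝ))).map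
              (QuotientGroup.mk' (Subgroup.center SL(2, ℝ)))) ≅
          planeComplFinite ({0, 1} : Set ℂ) (Set.toFinite _)) ∧
      ((fun Y : HolRS => Nonempty (Y ⟶ pslQuotient (((CongruenceSubgroup.Gamma 2).map
            (Matrix.SpecialLinearGroup.map (Int.castRingHom ℝ))).map
              (QuotientGroup.mk' (Subgroup.center SL(2, ℝ)))))) =
        fun Y : HolRS => Nonempty (Y ⟶ planeComplFinite ({0, 1} : Set ℂ) (Set.toFinite _))) ∧
      ((fun Y : RC => Nonempty (Y ⟶ toRC.obj (pslQuotient (((CongruenceSubgroup.Gamma 2).map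
            (Matrix.SpecialLinearGroup.map (Int.castRingHom ℝ))).map
              (QuotientGroup.mk' (Subgroup.center SL(2, ℝ))))))) =
        fun Y : RC => Nonempty (Y ⟶ toRC.obj (planeComplFinite ({0, 1} : Set ℂ) (Set.toFinite _)))) := by
  obtain ⟨hPD, hC, -, -, -, ⟨e, -⟩, hH, hR⟩ := pslGamma_two_uniformisation
  exact ⟨hPD, hC, ⟨e⟩, hH, hR⟩

end HolRS

end Literature.AnabelianGeometry.AbsoluteAnabelian

end
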